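import Summits.ABC.IUTFork.Cor312PilotIdelesMResidual
import Summits.ABC.IUTFork.Cor312SettingPrFramesM
import HarnessLib

/-!
# [IUTchIII] Cor. 3.12 — Team B's region-volume input `GlobalVolumeTransport` (G-c312-11-1) is FALSE at the M-LEVEL sharp settings
# over the genuine carriers `K_{v̲}`, in particular at the GENUINE setting of the datum's own ideles

PROOF-ONLY record file (D-0012; 0 definitions, 0 `Prop` facts) of the abc-iut cell (Cor. 3.12 cone, D-0067; wave-4 prover seat
abc-iut-w4-d067, gen 12; sequel of `Cor312SmallStableMGenuine` p442828/p443268 on the OTHER pre-registered input: GAP-LEDGER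
G-c312-11-1 / SUPPLEMENT, Team B's (G1′)-level candidate `Cor312Vol.GlobalVolumeTransport`). TAKES NO SIDE on [IUTchIII] Cor. 3.12.

abc-iut-c312-7's `not_globalVolumeTransport_settingPrVolSharp` (p426498) refutes Team B's input at the F-LEVEL print-normalised setting
with trivial archimedean container (`−deĝ_lgp(P_Θ) < −|log(q)|` by Dupuy–Hilado `deĝ_lgp(P_Θ) = ((ℓ⋇+1)(2ℓ⋇+1)/6)·deĝ(P_q)`); at the
honest-`∞` corner it becomes an explicit real inequality (`globalVolumeTransport_settingPrVolArchSharp_iff`, p435034). THIS FILE is the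
M-LEVEL twin at the faithful container (carriers `K_{v̲}`, `v̲ ∈ V̲` of [IUTchI] Def. 3.1 (e); the M-level files keep the F-level convention
of a trivial archimedean container), composing BY NAME the summand-route refutation `Cor312PilotIdelesMResidual` (general ideles: abc-iut-w5-d166
`processionNormalized_thetaRegion_settingPrVolM_sharp`, the `q`-numbers of `Cor312PilotIdelesMNumbersSummand`, abc-iut-c312-7's
`neg_ndegLgp_thetaPilot_lt_neg_ndeg_qPilot`, abc-iut-s2-p8's `bridgeHyps_settingPrVolSharpM_of_ideles`) with abc-iut-w5-d033's genuine
ideles and abc-iut-w4-d013's two-routes identities: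

* (the summand route with GENERAL ideles realising `P_Θ`, `P_q` is `Cor312PilotIdelesMResidual` — `neg_ndegLgp_thetaPilot_lt_negLogQ_settingPrVolSharpM`,
  `not_globalVolumeTransport_settingPrVolSharpM`, `not_volumeTransport_settingPrVolSharpM` — landed minutes before this file and consumed BY NAME);
* §1 the GENUINE ideles `tThetaM r` / `tqM r` of an idele datum `r` of `D` (abc-iut-w5-d033: realisation `log_norm_tThetaM` / `log_norm_tqM`
  and non-vanishing are THEOREMS): **`not_globalVolumeTransport_settingPrVolSharpM_genuine`**, `not_volumeTransport_settingPrVolSharpM_genuine`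
  — residual premises only the «units off a finite set» binders of the setting / of `BridgeHyps`;
* §2 the FRAMES route: the two containers agree on every Kummer image of the Θ-pilot object at the sharp boxes (hull-set preimages;
  abc-iut-w4-d013 `logvol_frameVolumePiecesOfInitialDH_preimage_of_isHullSet` with abc-iut-s2-p8 `isHullSet_thetaBoxM`), so
  `processionNormalized_thetaRegion_settingMSharp`, **`not_globalVolumeTransport_settingMSharp`** and its genuine form
  `not_globalVolumeTransport_settingMSharp_genuine` follow through abc-iut-w4-d013's `negLogQ_settingMSharp_eq`.
READING (neutral): like abc-iut-c312-7's F-level finding, this says the pre-registered REGION-VOLUME form of the (xi-g) input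
(per Kummer image, STRONGER-THAN-PRINT per G-c312-11-1-SUPPLEMENT) fails at the honestly computed M-level volumes with trivial `∞`
container; it does NOT evaluate the printed hull-level inequality. [claim: Mochizuki2012, status: disputed] for the quoted settings;
[cite: DupuyHilado2025, Def. 3.1.1, §3.4, §3.9, Thm. 3.10.1]; [cite: Mochizuki2012, IUTchIII Step (xi-g) p. 184]. HONEST FRAMING: no edit
to any parent file; every parent consumed BY NAME; nothing here bears on the truth of [IUTchIII] Cor. 3.12; typed ≠ proved;
instantiated ≠ endorsed.
-/

noncomputable section

open Set Function NumberField IsDedekindDomain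
open scoped Pointwise

namespace Summit.ABC.IUTFork.Thm311.Real

open Cor312 Cor312.Setting Cor312Vol Cor312Prov Literature.IUT.LogThetaLattice Literature.IUT.LogVolume
  Literature.IUT.HodgeTheaters Literature.NumberTheory.NumberFields

variable {F K Fbar : Type} [Field F] [NumberField F] [Field K] [NumberField K] [Algebra F K]
  [Field Fbar] [Algebra F Fbar] [Algebra K Fbar] {E : WeierstrassCurve F} [E.IsElliptic] {l : ℕ}
  {Pb : BadPlacePredicates K} (D : InitialThetaData F K Fbar E l Pb) {logvK : PadicLogsVal K}
  (hlog : LogvAnalyticVal logvK)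
  (M : Type) [Field M] [NumberField M]
  (archPk : ∀ (j : (thetaIndexOfInitial D).Label) (vQ : (thetaIndexOfInitial D).VQ),
    Set ((logShellsOfInitialDH D logvK).Packet j vQ))
  (archSub : ∀ (j : (thetaIndexOfInitial D).Label) (v : (thetaIndexOfInitial D).V),
    Set ((logShellsOfInitialDH D logvK).Packet j ((thetaIndexOfInitial D).over v)))
  (Ψ : ℤ → ∀ v : (thetaIndexOfInitial D).V, v ∈ (thetaIndexOfInitial D).Vbad →
    Set ((logShellsOfInitialDH D logvK).StarPacket v))
  (act : ℤ → ∀ v : (thetaIndexOfInitial D).V, v ∈ (thetaIndexOfInitial D).Vbad →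
    (logShellsOfInitialDH D logvK).StarPacket v → Module.End ℚ ((logShellsOfInitialDH D logvK).StarPacket v))
  (Mmod : ℤ → ∀ j : (thetaIndexOfInitial D).LabelStar, Set ((logShellsOfInitialDH D logvK).GlobalPacket j.1))
  (region : ℤ → ∀ j : (thetaIndexOfInitial D).LabelStar, FinDivisor M → ∀ vQ : (thetaIndexOfInitial D).VQ,
    Set ((logShellsOfInitialDH D logvK).Packet j.1 vQ))
  (n : ℤ) {HT : Type} {LogLink : HT → HT → Type} {IsFull : ∀ {s t : HT}, LogLink s t → Prop}
  (lat : LGPGaussianLogThetaLattice LogLink IsFull)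
  {Frd : Type} {IsoF : Frd → Frd → Type} {Ob : Frd → Type} {realify : Frd → Frd} {Strip : Type}
  {IsoS : Strip → Strip → Type}
  {Mv : ∀ v : (thetaIndexOfInitial D).V, v ∈ (thetaIndexOfInitial D).Vbad → Type} [∀ v h, Monoid (Mv v h)]
  (sig : GlobalLGPFrobenioidSignature (thetaIndexOfInitial D).lstar (thetaIndexOfInitial D).V
    (· ∈ (thetaIndexOfInitial D).Vbad) Frd IsoF Ob realify Strip IsoS Mv)
  (split : SplittingMonoids Mv) {ObΔ : Type}
  {N : ∀ v : (thetaIndexOfInitial D).V, v ∈ (thetaIndexOfInitial D).Vbad → Type} [∀ v h, Monoid (N v h)]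
  (qData : QPilotData ObΔ N)
  (t : ∀ (u : FinitePlace ℚ) (_ : Fin (thetaIndexOfInitial D).lstar) (x : (thetaIndexOfInitial D).Fibre (Val.non u)),
    kOfM D (ratChar u) u (natCast_ratChar_mem u) x)

/-! ## §1. The GENUINE ideles of an idele datum of `D` (summand route) -/

section Genuine

variable (r : ThetaData.IdeleData D) (Sq : Finset (FinitePlace ℚ))
  (htq1 : ∀ (u : FinitePlace ℚ) (x : (thetaIndexOfInitial D).Fibre (Val.non u)), u ∉ Sq →
    ‖tqM D (ratChar u) u (natCast_ratChar_mem u) r x‖ = 1)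

/-- **Team B's `GlobalVolumeTransport` is FALSE at the GENUINE M-level sharp setting** — the datum's own Θ-ideles `tThetaM r` and
`q`-ideles `tqM r` (abc-iut-w5-d033: non-vanishing and the realisations `log_norm_tThetaM` / `log_norm_tqM` are THEOREMS); residual premise
only the setting's «`q`-ideles units off a finite set» binder. [claim: Mochizuki2012, status: disputed]
[cite: Mochizuki2012, IUTchIII Step (xi-g) p. 184] [cite: DupuyHilado2025, §3.4, §3.9] -/
theorem not_globalVolumeTransport_settingPrVolSharpM_genuine :
    ¬ GlobalVolumeTransport (settingPrVolSharpM D hlog (fun u i x => tThetaM D (ratChar u) u (natCast_ratChar_mem u) r i x)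
      (fun u x => tqM D (ratChar u) u (natCast_ratChar_mem u) r x) M archPk archSub Ψ act Mmod region n lat sig split qData
      (fun u x => tqM_ne_zero D (ratChar u) u (natCast_ratChar_mem u) r x) Sq htq1) :=
  not_globalVolumeTransport_settingPrVolSharpM D hlog M archPk archSub Ψ act Mmod region n lat sig split qData _ _ _ Sq htq1
    (fun u i x => tThetaM_ne_zero D (ratChar u) u (natCast_ratChar_mem u) r i x)
    (fun u i x => log_norm_tThetaM D (ratChar u) u (natCast_ratChar_mem u) r i x)
    (fun u x => log_norm_tqM D (ratChar u) u (natCast_ratChar_mem u) r x)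

/-- **… and `VolumeTransport` is FALSE at the genuine M-level sharp setting**, for any finite set `Sθ` off which the genuine Θ-ideles are
units (a theorem for the places under `V^bad_mod`, abc-iut-w5-d033 `norm_tThetaM_eq_one_of_not_mem_image`).
[claim: Mochizuki2012, status: disputed] [cite: Mochizuki2012, IUTchIII Step (xi-g) p. 184] -/
theorem not_volumeTransport_settingPrVolSharpM_genuine (Sθ : Finset (FinitePlace ℚ))
    (ht1 : ∀ (u : FinitePlace ℚ) (i : Fin (thetaIndexOfInitial D).lstar) (x : (thetaIndexOfInitial D).Fibre (Val.non u)),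
      u ∉ Sθ → ‖tThetaM D (ratChar u) u (natCast_ratChar_mem u) r i x‖ = 1) :
    ¬ VolumeTransport (settingPrVolSharpM D hlog (fun u i x => tThetaM D (ratChar u) u (natCast_ratChar_mem u) r i x)
      (fun u x => tqM D (ratChar u) u (natCast_ratChar_mem u) r x) M archPk archSub Ψ act Mmod region n lat sig split qData
      (fun u x => tqM_ne_zero D (ratChar u) u (natCast_ratChar_mem u) r x) Sq htq1) :=
  not_volumeTransport_settingPrVolSharpM D hlog M archPk archSub Ψ act Mmod region n lat sig split qData _ _ _ Sq htq1
    (fun u i x => tThetaM_ne_zero D (ratChar u) u (natCast_ratChar_mem u) r i x)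
    (fun u i x => log_norm_tThetaM D (ratChar u) u (natCast_ratChar_mem u) r i x) Sθ ht1
    (fun u x => log_norm_tqM D (ratChar u) u (natCast_ratChar_mem u) r x)

end Genuine

/-! ## §2. The frames route `settingMSharp` (abc-iut-w5-d166): the two containers agree on every Kummer image of the Θ-pilot object -/

section Frames

variable (tq : ∀ (u : FinitePlace ℚ) (x : (thetaIndexOfInitial D).Fibre (Val.non u)),
    kOfM D (ratChar u) u (natCast_ratChar_mem u) x)
  (htq0 : ∀ u x, tq u x ≠ 0) (Sq : Finset (FinitePlace ℚ))
  (htq1 : ∀ (u : FinitePlace ℚ) (x : (thetaIndexOfInitial D).Fibre (Val.non u)), u ∉ Sq → ‖tq u x‖ = 1)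
  (ht0 : ∀ u i x, t u i x ≠ 0)

include ht0 in
/-- **The field-box volume of every Kummer image of the Θ-pilot object at the sharp boxes IS its summandwise volume** (the image is the
preimage of the sharp box, a HULL-SET at every place: abc-iut-s2-p8 `isHullSet_thetaBoxM`; the containers agree there: abc-iut-w4-d013
`logvol_frameVolumePiecesOfInitialDH_preimage_of_isHullSet`). [claim: Mochizuki2012, status: disputed] -/
theorem logvol_thetaRegion_settingMSharp_eq (m : ℤ) (j : (thetaIndexOfInitial D).Label) (vQ : (thetaIndexOfInitial D).VQ) :
    ((situationMFrames D hlog M archPk archSub Ψ act Mmod region).D n).logvol j vQ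
        ((settingMSharp D hlog M archPk archSub Ψ act Mmod region n lat sig split qData t tq htq0 Sq htq1).thetaRegion m j vQ) =
      ((situationPrVolM D hlog M archPk archSub Ψ act Mmod region).D n).logvol j vQ
        ((settingPrVolSharpM D hlog t tq M archPk archSub Ψ act Mmod region n lat sig split qData htq0 Sq htq1).thetaRegion m j vQ) := by
  rw [settingMSharp_thetaRegion, thetaRegion_settingPrVolSharpM]
  exact logvol_frameVolumePiecesOfInitialDH_preimage_of_isHullSet D hlog M archPk archSub Ψ act Mmod region n j vQ
    (isHullSet_thetaBoxM D hlog t ht0 j vQ)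

include ht0 in
/-- Hence the procession-normalised global volume of any family of Kummer images is the SAME number on the two routes. [folklore] -/
theorem processionNormalized_thetaRegion_settingMSharp_eq
    (m : Fin (thetaIndexOfInitial D).lstar → (thetaIndexOfInitial D).VQ → ℤ) :
    processionNormalized (fun i : Fin (thetaIndexOfInitial D).lstar => ∑ᶠ vQ : (thetaIndexOfInitial D).VQ,
        ((situationMFrames D hlog M archPk archSub Ψ act Mmod region).D n).logvol (labelSucc i) vQ
          ((settingMSharp D hlog M archPk archSub Ψ act Mmod region n lat sig split qData t tq htq0 Sq htq1).thetaRegion (m i vQ)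
            (labelSucc i) vQ)) =
      processionNormalized (fun i : Fin (thetaIndexOfInitial D).lstar => ∑ᶠ vQ : (thetaIndexOfInitial D).VQ,
        ((situationPrVolM D hlog M archPk archSub Ψ act Mmod region).D n).logvol (labelSucc i) vQ
          ((settingPrVolSharpM D hlog t tq M archPk archSub Ψ act Mmod region n lat sig split qData htq0 Sq htq1).thetaRegion
            (m i vQ) (labelSucc i) vQ)) := by
  simp only [logvol_thetaRegion_settingMSharp_eq D hlog M archPk archSub Ψ act Mmod region n lat sig split qData t tq htq0 Sq htq1 ht0]

include ht0 in
/-- **Team B's `GlobalVolumeTransport` is FALSE at abc-iut-w5-d166's frames-route sharp setting `settingMSharp`** for ideles realising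
`P_Θ`, `P_q` (the inequality is the summand-route one: same Θ-side number by the preceding theorem, same `−|log(q)|` by abc-iut-w4-d013's
`negLogQ_settingMSharp_eq`). [claim: Mochizuki2012, status: disputed] [cite: Mochizuki2012, IUTchIII Step (xi-g) p. 184] -/
theorem not_globalVolumeTransport_settingMSharp
    (ht : ∀ (u : FinitePlace ℚ) (i : Fin (thetaIndexOfInitial D).lstar) (x : (thetaIndexOfInitial D).Fibre (Val.non u)),
      Real.log ‖t u i x‖ =
        -((ThetaData.pilotData D).thetaPilot i (placeModOfM D u x)) * logNorm (fieldOfModuli E) (placeModOfM D u x) /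
          localDegree (fieldOfModuli E) (placeModOfM D u x))
    (htq : ∀ (u : FinitePlace ℚ) (x : (thetaIndexOfInitial D).Fibre (Val.non u)),
      Real.log ‖tq u x‖ = -((ThetaData.pilotData D).qPilot (placeModOfM D u x)) * logNorm (fieldOfModuli E) (placeModOfM D u x) /
        localDegree (fieldOfModuli E) (placeModOfM D u x)) :
    ¬ GlobalVolumeTransport (settingMSharp D hlog M archPk archSub Ψ act Mmod region n lat sig split qData t tq htq0 Sq htq1) := by
  rintro ⟨m, -, hle⟩
  rw [show (settingMSharp D hlog M archPk archSub Ψ act Mmod region n lat sig split qData t tq htq0 Sq htq1).n = n from rfl,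
    processionNormalized_thetaRegion_settingMSharp_eq D hlog M archPk archSub Ψ act Mmod region n lat sig split qData t tq htq0 Sq
      htq1 ht0,
    negLogQ_settingMSharp_eq] at hle
  exact absurd hle (not_le.mpr (neg_ndegLgp_thetaPilot_lt_negLogQ_settingPrVolSharpM D hlog M archPk archSub Ψ act Mmod region n
    lat sig split qData t tq htq0 Sq htq1 ht0 ht htq m))

end Frames

section FramesGenuine

variable (r : ThetaData.IdeleData D) (Sq : Finset (FinitePlace ℚ))
  (htq1 : ∀ (u : FinitePlace ℚ) (x : (thetaIndexOfInitial D).Fibre (Val.non u)), u ∉ Sq →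
    ‖tqM D (ratChar u) u (natCast_ratChar_mem u) r x‖ = 1)

/-- **Team B's `GlobalVolumeTransport` is FALSE at the GENUINE frames-route sharp setting** (the datum's own ideles; residual premise only
the «`q`-ideles units off a finite set» binder of the setting). [claim: Mochizuki2012, status: disputed]
[cite: Mochizuki2012, IUTchIII Step (xi-g) p. 184] [cite: DupuyHilado2025, §3.4, §3.9] -/
theorem not_globalVolumeTransport_settingMSharp_genuine :
    ¬ GlobalVolumeTransport (settingMSharp D hlog M archPk archSub Ψ act Mmod region n lat sig split qData
      (fun u i x => tThetaM D (ratChar u) u (natCast_ratChar_mem u) r i x)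
      (fun u x => tqM D (ratChar u) u (natCast_ratChar_mem u) r x)
      (fun u x => tqM_ne_zero D (ratChar u) u (natCast_ratChar_mem u) r x) Sq htq1) :=
  not_globalVolumeTransport_settingMSharp D hlog M archPk archSub Ψ act Mmod region n lat sig split qData _ _ _ Sq htq1
    (fun u i x => tThetaM_ne_zero D (ratChar u) u (natCast_ratChar_mem u) r i x)
    (fun u i x => log_norm_tThetaM D (ratChar u) u (natCast_ratChar_mem u) r i x)
    (fun u x => log_norm_tqM D (ratChar u) u (natCast_ratChar_mem u) r x)

end FramesGenuine

end Summit.ABC.IUTFork.Thm311.Real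

end
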